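import Mathlib
import Literature.FieldTheory.RealClosed.TraceFormFibres
import Literature.AlgebraicGeometry.DeterminantalHypersurfaces.RealFibresUnramified
import HarnessLib

/-!
# Bender–Hanselka lattice data: unimodular, positive scaled trace forms on fractional ideals

Topic `Literature/AlgebraicGeometry/DeterminantalHypersurfaces`. The two properties of the
scaled trace form `β(u, v) = Tr_{L|K}(c u v)` on a fractional ideal `I` that C. Hanselka,
*Characteristic polynomials of symmetric matrices over the univariate polynomial ring*, J. Algebra
487 (2017) 340–356, uses in **§5** (proof of Theorem 1) — in the matrix form consumed by
`exists_isSymm_charpoly_eq_of_lattice_data` (`SpectralRepresentationFromLattice.lean`):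

* `exists_basis_of_fractionalIdeal` — a non-zero fractional ideal `I` of the integral closure
  `B` of a principal ideal domain `A` in `L` ("Since `A` is a principal ideal domain and `I` is
  finitely generated and torsion free as an `A`-module, it is already free", ibid. §5) has an
  `A`-basis which is a `K`-basis of `L`, all elements of `I` having coordinates in `A`
  [folklore];
* `exists_lattice_data_of_spanSingleton_mul_sq_eq_dual` — **Lemma 2.1 (c)** ("If `B` is a
  Dedekind domain and `I` is a fractional `B`-ideal then `β` restricts to a unimodular form on `I`
  if and only if `cI² = Δ(B|A)`", the "if" direction): if `c I² = Δ(B|A)` (Mathlib's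
  `FractionalIdeal.dual A K 1`), then in such a basis `b` the Gram matrix `G = (Tr(c bᵢ bⱼ))`
  has entries in `A` and unit determinant, and multiplication by an `A`-integral `θ` has a
  matrix `N` with entries in `A` [cite: Hanselka2017, Lemma 2.1 (c)];
* `posSemidef_map_eval_of_trace_sq_add_sq` — **positivity** (ibid. §5: "These must be positive
  as follows easily from Sylvester's Lemma since `c` is a sum of squares"): over `A = ℝ[x]`, for
  a real-rooted family and `c = s² + t²`, `G(a)` is positive semidefinite for every real `a`
  (`vᵀGv = Tr((su)²) + Tr((tu)²)` and `Literature.FieldTheory.RealClosed.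
  exists_sq_mul_trace_mul_self_eq`) [cite: Hanselka2017, §5].

All statements are theorems; no definitions, no named facts.

## References

* [Hanselka2017] C. Hanselka, J. Algebra 487 (2017) 340–356: Lemma 2.1, §5.
* E. A. Bender, Classes of matrices over an integral domain, Illinois J. Math. 11 (1967) 697–702.
-/

noncomputable section

open Polynomial nonZeroDivisors Module

namespace Literature.AlgebraicGeometry.DeterminantalHypersurfaces

section LatticeData

variable (A K : Type*) {L B : Type*} [CommRing A] [IsDomain A] [IsPrincipalIdealRing A]
  [Field K] [Field L] [Algebra A K] [IsFractionRing A K] [Algebra K L] [Algebra A L]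
  [IsScalarTower A K L] [FiniteDimensional K L] [Algebra.IsSeparable K L]
  [CommRing B] [IsDedekindDomain B] [Algebra A B] [Algebra B L] [IsScalarTower A B L]
  [IsIntegralClosure B A L] [IsFractionRing B L] [Module.Finite A B]

/-- **An `A`-basis of a fractional ideal is a `K`-basis of `L`.** For a non-zero fractional
ideal `I` of the integral closure `B` of the principal ideal domain `A` in `L`, the (free)
`A`-module `I` has an `A`-basis indexed by `Fin [L:K]` which is a `K`-basis of `L`; every
element of `I` has coordinates in `A`. [folklore] -/
theorem exists_basis_of_fractionalIdeal {I : FractionalIdeal B⁰ L} (hI0 : I ≠ 0) {n : ℕ}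
    (hn : Module.finrank K L = n) :
    ∃ b : Module.Basis (Fin n) K L,
      (∀ i, b i ∈ I) ∧ ∀ x ∈ I, ∃ a : Fin n → A, x = ∑ i, algebraMap A K (a i) • b i := by
  classical
  haveI : Module.IsTorsionFree A L := .trans_faithfulSMul A K L
  haveI : IsNoetherian B I := FractionalIdeal.isNoetherian I
  haveI : Module.Finite A I := Module.Finite.trans B I
  haveI : Module.IsTorsionFree A I :=
    Subtype.val_injective.moduleIsTorsionFree (fun x : I => (x : L)) fun _ _ => rfl
  haveI : Module.Free A I := Module.free_of_finite_type_torsion_free'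
  let bM := Module.Free.chooseBasis A I
  set v : Module.Free.ChooseBasisIndex A I → L := fun i => (bM i : L) with hv
  -- coordinates in `A` of the elements of `I`
  have hrep : ∀ y (hy : y ∈ I), y = ∑ i, algebraMap A K (bM.repr ⟨y, hy⟩ i) • v i := by
    intro y hy
    have h := congrArg (fun z : I => (z : L)) (bM.sum_repr ⟨y, hy⟩)
    simp only [AddSubmonoidClass.coe_finsetSum, Submodule.coe_smul_of_tower] at h
    calc y = ∑ i, (bM.repr ⟨y, hy⟩) i • (bM i : L) := h.symm
      _ = ∑ i, algebraMap A K (bM.repr ⟨y, hy⟩ i) • v i :=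
          Finset.sum_congr rfl fun i _ => by rw [algebraMap_smul]
  -- linear independence over `A`, hence over `K`
  have hvA : LinearIndependent A v :=
    bM.linearIndependent.map' (((I : Submodule B L).restrictScalars A).subtype)
      (Submodule.ker_subtype _)
  have hvK : LinearIndependent K v := (LinearIndependent.iff_fractionRing A K).mp hvA
  -- spanning
  haveI := IsIntegralClosure.isLocalization A K L B
  have hspan : ∀ x : L, x ∈ Submodule.span K (Set.range v) := by
    intro x
    have hIspan : ∀ y ∈ I, y ∈ Submodule.span K (Set.range v) := by
      intro y hy
      rw [hrep y hy]
      exact Submodule.sum_mem _ fun i _ =>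
        Submodule.smul_mem _ _ (Submodule.subset_span (Set.mem_range_self i))
    obtain ⟨i₀, hi₀I, hi₀⟩ : ∃ i₀ ∈ I, i₀ ≠ (0 : L) := by
      by_contra h
      exact hI0 (FractionalIdeal.eq_zero_iff.mpr fun y hy =>
        Classical.byContradiction fun hy0 => h ⟨y, hy, hy0⟩)
    obtain ⟨⟨β, a⟩, h⟩ := IsLocalization.surj (Algebra.algebraMapSubmonoid B A⁰) (x / i₀)
    obtain ⟨a', ha', ha⟩ := a.2
    have ha'0 : algebraMap A K a' ≠ 0 :=
      (map_ne_zero_iff _ (IsFractionRing.injective A K)).mpr (nonZeroDivisors.ne_zero ha')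
    have hx : x = (algebraMap A K a')⁻¹ • (algebraMap B L β * i₀) := by
      simp only at h
      rw [← ha, ← IsScalarTower.algebraMap_apply, IsScalarTower.algebraMap_apply A K L] at h
      rw [Algebra.smul_def, map_inv₀, ← h]
      have hne : algebraMap K L (algebraMap A K a') ≠ 0 := (_root_.map_ne_zero _).mpr ha'0
      field_simp
    rw [hx]
    refine Submodule.smul_mem _ _ (hIspan _ ?_)
    rw [← Algebra.smul_def]
    exact (I : Submodule B L).smul_mem β hi₀I
  let b₀ := Module.Basis.mk hvK fun x _ => hspan x
  have hb₀ : ∀ i, b₀ i = v i := fun i => Module.Basis.mk_apply _ _ _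
  -- cardinality and reindexing
  have hcard : Fintype.card (Module.Free.ChooseBasisIndex A I) = n :=
    (Module.finrank_eq_card_basis b₀).symm.trans hn
  let e := Fintype.equivFinOfCardEq hcard
  refine ⟨b₀.reindex e, fun i => ?_, fun x hx => ?_⟩
  · rw [Module.Basis.reindex_apply, hb₀]
    exact (bM _).2
  · refine ⟨fun i => bM.repr ⟨x, hx⟩ (e.symm i), ?_⟩
    conv_lhs => rw [hrep x hx]
    rw [← Equiv.sum_comp e.symm]
    refine Finset.sum_congr rfl fun i _ => ?_
    rw [Module.Basis.reindex_apply, hb₀]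

/-- **Bender's lemma (Hanselka 2017, Lemma 2.1 (c)) with the multiplication matrix.** Let `I` be a
fractional ideal of `B` (integral closure of the principal ideal domain `A` in `L`) and `c ∈ L`
with `c I² = Δ(B|A)` (the codifferent, `FractionalIdeal.dual A K 1`). Then for an `A`-basis
`b` of `I` (a `K`-basis of `L`), the Gram matrix `G = (Tr_{L|K}(c bᵢ bⱼ))` has entries in
`A` and unit determinant — the scaled trace form `(u, v) ↦ Tr(c u v)` is unimodular on `I` — and
multiplication by any `A`-integral `θ` has a matrix `N` with entries in `A` in this basis.
Proof of unimodularity: `dual(I) = Δ I⁻¹ = c I`, so the trace-dual basis `bᵛ` and `c b` span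
the same `A`-lattice; `c bⱼ = Σᵢ Gᵢⱼ bᵢᵛ` and `bᵢᵛ = Σₖ Hₖᵢ (c bₖ)` give `G H = 1`.
[cite: Hanselka2017, Lemma 2.1 (c) and §5 ("the scaled trace form … is well-defined and
unimodular")] -/
theorem exists_lattice_data_of_spanSingleton_mul_sq_eq_dual {I : FractionalIdeal B⁰ L} {c : L}
    (hcI : FractionalIdeal.spanSingleton B⁰ c * I ^ 2 = FractionalIdeal.dual A K 1)
    {θ : L} (hθ : IsIntegral A θ) {n : ℕ} (hn : Module.finrank K L = n) :
    ∃ (b : Module.Basis (Fin n) K L) (N G : Matrix (Fin n) (Fin n) A),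
      (∀ j, θ * b j = ∑ i, algebraMap A K (N i j) • b i) ∧
      (∀ i j, algebraMap A K (G i j) = Algebra.trace K L (c * (b i * b j))) ∧
      IsUnit G.det := by
  classical
  have hdual0 : FractionalIdeal.dual A K (1 : FractionalIdeal B⁰ L) ≠ 0 :=
    FractionalIdeal.dual_ne_zero A K one_ne_zero
  have hI0 : I ≠ 0 := by
    rintro rfl
    rw [zero_pow two_ne_zero, mul_zero] at hcI
    exact hdual0 hcI.symm
  obtain ⟨b, hbI, hrep⟩ := exists_basis_of_fractionalIdeal A K hI0 hn
  -- `N`: multiplication by `θ ∈ B` preserves `I`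
  obtain ⟨θB, hθB⟩ : ∃ θB : B, algebraMap B L θB = θ :=
    (IsIntegralClosure.isIntegral_iff (A := B)).mp hθ
  have hθI : ∀ j, θ * b j ∈ I := fun j => by
    rw [← hθB, ← Algebra.smul_def]
    exact (I : Submodule B L).smul_mem θB (hbI j)
  choose Nf hNf using fun j => hrep (θ * b j) (hθI j)
  -- `G`: `c bᵢ bⱼ ∈ c I² = Δ`, so its trace is in `A`
  have hcbb : ∀ i j, c * (b i * b j) ∈ FractionalIdeal.dual A K (1 : FractionalIdeal B⁰ L) := by
    intro i j
    rw [← hcI, pow_two, ← mul_assoc, ← mul_assoc]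
    exact FractionalIdeal.mul_mem_mul (FractionalIdeal.mul_mem_mul
      (FractionalIdeal.mem_spanSingleton_self _ _) (hbI i)) (hbI j)
  have hGex : ∀ i j, ∃ g : A, algebraMap A K g = Algebra.trace K L (c * (b i * b j)) := by
    intro i j
    obtain ⟨g, hg⟩ := (FractionalIdeal.mem_dual
      (one_ne_zero : (1 : FractionalIdeal B⁰ L) ≠ 0)).mp (hcbb i j) 1
      (by simp)
    exact ⟨g, by rw [hg, Algebra.traceForm_apply, mul_one]⟩
  choose Gf hGf using hGex
  refine ⟨b, Matrix.of fun i j => Nf j i, Matrix.of fun i j => Gf i j, fun j => ?_, fun i j => ?_,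
    ?_⟩
  · simp only [Matrix.of_apply]
    exact hNf j
  · simp only [Matrix.of_apply]
    exact hGf i j
  -- unimodularity
  set G : Matrix (Fin n) (Fin n) A := Matrix.of fun i j => Gf i j with hGdef
  have hnd : (Algebra.traceForm K L).Nondegenerate := traceForm_nondegenerate K L
  set d := (Algebra.traceForm K L).dualBasis hnd b with hd
  -- (a) `c bⱼ = Σᵢ Gᵢⱼ bᵢᵛ`
  have ha : ∀ j, c * b j = ∑ i, algebraMap A K (G i j) • d i := by
    intro j
    conv_lhs => rw [← d.sum_repr (c * b j)]
    refine Finset.sum_congr rfl fun i _ => ?_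
    rw [hd, LinearMap.BilinForm.dualBasis_repr_apply, hGdef, Matrix.of_apply, hGf,
      Algebra.traceForm_apply]
    congr 2
    ring
  -- (b) `bᵢᵛ ∈ dual I = c I`
  have hdualI : FractionalIdeal.dual A K I = FractionalIdeal.spanSingleton B⁰ c * I := by
    rw [FractionalIdeal.dual_eq_mul_inv A K I, ← hcI, pow_two, mul_assoc, mul_assoc,
      mul_inv_cancel₀ hI0, mul_one]
  have hdi : ∀ i, d i ∈ FractionalIdeal.dual A K I := by
    intro i
    rw [FractionalIdeal.mem_dual hI0]
    intro y hy
    obtain ⟨a, rfl⟩ := hrep y hy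
    rw [map_sum]
    refine Subring.sum_mem _ fun k _ => ?_
    rw [map_smul, smul_eq_mul, hd, LinearMap.BilinForm.apply_dualBasis_left]
    refine Subring.mul_mem _ ⟨a k, rfl⟩ ?_
    split_ifs
    · exact Subring.one_mem _
    · exact Subring.zero_mem _
  have hdex : ∀ i, ∃ h : Fin n → A, d i = ∑ k, algebraMap A K (h k) • (c * b k) := by
    intro i
    have hmem : d i ∈ FractionalIdeal.spanSingleton B⁰ c * I := hdualI ▸ hdi i
    obtain ⟨y, hy, hdy⟩ := FractionalIdeal.mem_singleton_mul.mp hmem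
    obtain ⟨h, rfl⟩ := hrep y hy
    refine ⟨h, ?_⟩
    rw [hdy, Finset.mul_sum]
    refine Finset.sum_congr rfl fun k _ => ?_
    rw [mul_smul_comm]
  choose Hf hHf using hdex
  set H : Matrix (Fin n) (Fin n) A := Matrix.of fun k i => Hf i k with hHdef
  -- (c) `G H = 1`
  have hGH : G.map (algebraMap A K) * H.map (algebraMap A K) = 1 := by
    ext l i
    have key : d i = ∑ m, (∑ k, algebraMap A K (G m k) * algebraMap A K (H k i)) • d m := by
      conv_lhs => rw [hHf i]
      simp_rw [ha, Finset.smul_sum, smul_smul]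
      rw [Finset.sum_comm]
      refine Finset.sum_congr rfl fun m _ => ?_
      rw [Finset.sum_smul]
      refine Finset.sum_congr rfl fun k _ => ?_
      rw [hHdef, Matrix.of_apply, mul_comm]
    have hco : (∑ k, algebraMap A K (G l k) * algebraMap A K (H k i)) =
        if l = i then 1 else 0 := by
      have h1 := congrArg (fun x => (d.repr x : Fin n → K) l) key
      simp only [d.repr_self, d.repr_sum_self] at h1
      rw [Finsupp.single_apply] at h1
      rw [← h1]
      by_cases h : i = l
      · simp [h]
      · simp [h, Ne.symm h]
    rw [Matrix.mul_apply, Matrix.one_apply]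
    simp only [Matrix.map_apply]
    exact hco
  have hGH' : G * H = 1 := by
    refine Matrix.map_injective (IsFractionRing.injective A K) ?_
    change (G * H).map (algebraMap A K) = (1 : Matrix _ _ A).map (algebraMap A K)
    rw [Matrix.map_mul, hGH, Matrix.map_one _ (map_zero _) (map_one _)]
  exact Matrix.isUnit_det_of_right_inverse hGH'

end LatticeData

/-! ### Positivity at real points -/

open Matrix in
/-- **Positivity of the scaled trace form at real points** ([Hanselka2017, §5]: "These must be
positive as follows easily from Sylvester's Lemma since `c` is a sum of squares"): let
`f ∈ ℝ[x][t]` be monic with real-rooted fibres, `L ⊇ K = Frac ℝ[x]` with a power basis whose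
generator has minimal polynomial `f`, `c = s² + t²` (`s, t ∈ L`), and `G ∈ Mₙ(ℝ[x])` a matrix
with `Gᵢⱼ = Tr_{L|K}(c bᵢ bⱼ)` for some `bᵢ ∈ L`. Then `G(a)` is positive semidefinite for every
real `a`: `vᵀ G v = Tr(c u²) = Tr((su)²) + Tr((tu)²)` with `u = Σ vᵢ bᵢ`, and each `Tr(y²)` is a
non-negative polynomial over a square (`exists_sq_mul_trace_mul_self_eq`).
[cite: Hanselka2017, §5 (proof of Thm. 1, positivity of the orthogonal basis) with Cor. 3.1] -/
theorem posSemidef_map_eval_of_trace_sq_add_sq {K L : Type*} [Field K] [CommRing L]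
    [Algebra ℝ[X] K] [IsFractionRing ℝ[X] K] [Algebra K L] {f : ℝ[X][X]} (hf : f.Monic)
    (hroots : ∀ a : ℝ, Multiset.card (f.map (evalRingHom a)).roots = f.natDegree)
    (pb : PowerBasis K L) (hpb : minpoly K pb.gen = f.map (algebraMap ℝ[X] K))
    {ι : Type*} [Fintype ι] [DecidableEq ι] (b : ι → L) (s t : L) (G : Matrix ι ι ℝ[X])
    (hG : ∀ i j, algebraMap ℝ[X] K (G i j) = Algebra.trace K L ((s ^ 2 + t ^ 2) * (b i * b j)))
    (a : ℝ) : (G.map (Polynomial.eval a)).PosSemidef := by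
  have hinj : Function.Injective (algebraMap ℝ[X] K) := IsFractionRing.injective ℝ[X] K
  -- symmetry
  have hsymm : G.IsSymm := Matrix.IsSymm.ext fun i j => by
    apply hinj
    rw [hG, hG, mul_comm (b j)]
  refine PosSemidef.of_dotProduct_mulVec_nonneg ?_ fun x => ?_
  · show (G.map (Polynomial.eval a))ᴴ = G.map (Polynomial.eval a)
    rw [conjTranspose_eq_transpose_of_trivial, ← transpose_map, hsymm.eq]
  · -- the quadratic form as a polynomial
    set Q : ℝ[X] := ∑ i, ∑ j, C (x i) * C (x j) * G i j with hQ
    have hQeval : star x ⬝ᵥ (G.map (Polynomial.eval a) *ᵥ x) = Q.eval a := by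
      simp only [star_trivial, dotProduct, mulVec, Matrix.map_apply, hQ, eval_finsetSum,
        eval_mul, eval_C, Finset.mul_sum]
      refine Finset.sum_congr rfl fun i _ => Finset.sum_congr rfl fun j _ => ?_
      ring
    rw [hQeval]
    -- `Q = Tr(c u²)` with `u = Σ xᵢ bᵢ`
    set u : L := ∑ i, algebraMap ℝ[X] K (C (x i)) • b i with hu
    have hQtr : algebraMap ℝ[X] K Q = Algebra.trace K L ((s ^ 2 + t ^ 2) * (u * u)) := by
      have huu : (s ^ 2 + t ^ 2) * (u * u) = ∑ i, ∑ j,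
          (algebraMap ℝ[X] K (C (x i)) * algebraMap ℝ[X] K (C (x j))) •
            ((s ^ 2 + t ^ 2) * (b i * b j)) := by
        rw [hu, Finset.sum_mul, Finset.mul_sum]
        refine Finset.sum_congr rfl fun i _ => ?_
        rw [Finset.mul_sum, Finset.mul_sum]
        refine Finset.sum_congr rfl fun j _ => ?_
        rw [smul_mul_smul_comm, mul_smul_comm]
      rw [huu, map_sum (Algebra.trace K L), hQ, map_sum (algebraMap ℝ[X] K)]
      refine Finset.sum_congr rfl fun i _ => ?_
      rw [map_sum (algebraMap ℝ[X] K), map_sum (Algebra.trace K L)]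
      refine Finset.sum_congr rfl fun j _ => ?_
      rw [LinearMap.map_smul, smul_eq_mul, (algebraMap ℝ[X] K).map_mul,
        (algebraMap ℝ[X] K).map_mul, hG]
    -- `c u² = (su)² + (tu)²`, each trace a non-negative polynomial over a square
    obtain ⟨P₁, D₁, hD₁, hP₁, h₁⟩ :=
      Literature.FieldTheory.RealClosed.exists_sq_mul_trace_mul_self_eq hf hroots pb hpb (s * u)
    obtain ⟨P₂, D₂, hD₂, hP₂, h₂⟩ :=
      Literature.FieldTheory.RealClosed.exists_sq_mul_trace_mul_self_eq hf hroots pb hpb (t * u)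
    have hident : (D₁ * D₂) ^ 2 * Q = D₂ ^ 2 * P₁ + D₁ ^ 2 * P₂ := by
      apply hinj
      have hsplit : Algebra.trace K L ((s ^ 2 + t ^ 2) * (u * u)) =
          Algebra.trace K L (s * u * (s * u)) + Algebra.trace K L (t * u * (t * u)) := by
        rw [← map_add]
        congr 1
        ring
      rw [(algebraMap ℝ[X] K).map_mul, (algebraMap ℝ[X] K).map_pow, (algebraMap ℝ[X] K).map_mul,
        hQtr, hsplit, (algebraMap ℝ[X] K).map_add, (algebraMap ℝ[X] K).map_mul,
        (algebraMap ℝ[X] K).map_mul, ← h₁, ← h₂]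
      simp only [map_pow]
      ring
    refine eval_nonneg_of_sq_mul_eval_nonneg (mul_ne_zero hD₁ hD₂) (fun y => ?_) a
    rw [← eval_pow, ← eval_mul, hident, eval_add, eval_mul, eval_mul, eval_pow, eval_pow]
    exact add_nonneg (mul_nonneg (sq_nonneg _) (hP₁ y)) (mul_nonneg (sq_nonneg _) (hP₂ y))

end Literature.AlgebraicGeometry.DeterminantalHypersurfaces
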